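import Summits.QuantumFields.YangMills.Theorems.UnitScaleTiltProp7CovLineIterGradT3
import Summits.QuantumFields.YangMills.Theorems.UnitScaleTiltProp7CovGradSplit
import Summits.QuantumFields.YangMills.Theorems.UnitScaleTiltProp7TrueLinIterDefect
import Summits.QuantumFields.YangMills.Theorems.UnitScaleTiltProp7CovIterLambdaEnergy
import HarnessLib

/-!
# Route `UnitScaleTilt`, crux K1 «MinimiserStabilityRegPr» (stmt-QuantumFields-19200), route-R [RP] at a curved background — THE CURVED N6, ROW (R-B), FINAL ASSEMBLY
# at `d = 3`: the `hΛ` row of ✓ p601741 for the recursion of record, the displayed (hgrad)∕(hmass) rows of ✓ p612184 DISCHARGED by the pure `LINE`-tower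
# (✓ p615292), the reduced-vs-line defect of ★w2-20520 g3 (✓ p608741) and the gradient split (✓ p615606)

Cell `ym3-torus`, D-0154 (3c) R3 twin-width seat `ym-routeR-w2` (W-SEAT MAP pass #3 row M9; architecture «ℓ²-Minkowski over levels, level-local», ★★OWNER g26 ACK 12).
THEOREMS ONLY (0 `def`, 0 `sorry`); `--supports stmt-QuantumFields-19200`, count-neutral.  YM₃ on T³ is a ladder rung (R3), not the Clay problem; nothing here claims S2, P, the
crux or the gap — this is the curved N6's `(H¹)^*`-bound of the coarse gauge function, with explicit constants, uniformly in the volume and in `k`.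

THE STATEMENT (★★★ `sum_normSq_covIterLambda_le_T3`).  `d = 3`; `U₀ ∈ SU(N)` with `PlaqSmall (ε(L^k)⁻²) U₀` in the [B7] Prop. 2 regime and `((d+2)L)²/4·2ε ≤ 1/24`;
`G`, `Λ` the reduced∕gauge families of the curved structure theorem (✓ p606268: `G_0 = Y`, `G_{j+1} = T_j G_j − P∘CM_j(G_j)`, `Λ_0 = 0`, `Λ_{j+1} = CM_j(G_j) + Λ_j∘emb`),
`S` the pure `LINE`-iterate (`S_0 = Y`, `S_{j+1} = LINE_j(S_j)`).  Then
`Σ_y ‖Λ_k(y)‖² ≤ [25N·L⁴·E + 100·27(3N+6)·L⁶·E′]·L^k/(√L−1)²`, `E = (√Σ‖∇^{U₀}Y‖² + C₁·ε·L²(L^k)⁻¹·√Σ‖Y‖²)²`, `E′ = 4ε²(L^k)⁻²e_k²·Σ‖Y‖²`,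
`C₁ = 154√3 + 25√3·√L·κ′·e_k`, `κ′ = 159(d+2)L√(2dL^d·2d)`, `e_k = exp((κ′√L)·Σ_{j<k}θ_j)`, `θ_j = ((d+2)L)²/4·2ε(L^j/L^k)²` (`Σθ_j ≤ (25/2)εL²·L²/(L²−1)`, so `e_k` is
k-uniformly bounded for `ε ≤ c·L^{−5}`).

References: T. Bałaban, CMP 95 (1984) 17–40 [Balaban1984PropagatorsI] ((1.18)–(1.20) pp.19–20); CMP 99 (1985) 389–434 [Balaban1985BackgroundPropagators] (Thm 3.11 p.416);
CMP 98 (1985) 17–51 [Balaban1985Averaging] (Prop. 2 (53) p.26, (124) p.36).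
-/

noncomputable section

open scoped BigOperators Matrix.Norms.L2Operator

namespace Summit.QuantumFields.YangMills.Theorems.Prop7CovIterLambdaHLambda

open Literature.MathematicalPhysics.QuantumFieldTheory.Balaban1983to89
open Finset T4Continuum BlockAveraging AveragingRT ExpMeanLog BlockAveragingEMLLinearised BlockAveragingEMLLinearisedBackground BlockAveragingEMLProp2
open LatticeWordStokes (dist1_loopHol_le)
open Summit.QuantumFields.YangMills.Theorems.Prop7CovIterLambdaBound (tower_plaq_lt)
open Summit.QuantumFields.YangMills.Theorems.Prop7CovLineIterGrad (theta_lt_deltaSU)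
open Summit.QuantumFields.YangMills.Theorems.Prop7CovLineIterGradT3 (lineIter_mass_grad_le_T3 rho_m_eq)
open Summit.QuantumFields.YangMills.Theorems.Prop7CovGradSplit (sqrt_sum_normSq_covGrad_le_mass sqrt_sum_normSq_covGrad_add_le)
open Summit.QuantumFields.YangMills.Theorems.Prop7TrueLinIterDefect (sqrt_sum_normSq_reduced_sub_lineIter_le)
open Summit.QuantumFields.YangMills.Theorems.Prop7CovIterLambdaEnergy (sum_normSq_covIterLambda_le)
open Summit.QuantumFields.YangMills.Theorems.ChartHInv (sum_range_pow_le)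

variable {P : Params} {N : ℕ} [NeZero N]

omit [NeZero N] in
/-- `Σ_{i<j} L^{2i} ≤ L^j·L^j`. [folklore] -/
theorem sum_range_pow_two_mul_le (j : ℕ) : ∑ i ∈ range j, ((P.L : ℝ) ^ i) ^ 2 ≤ (P.L : ℝ) ^ j * (P.L : ℝ) ^ j := by
  have hL1 : (1 : ℝ) ≤ P.L := by exact_mod_cast P.L_pos
  calc ∑ i ∈ range j, ((P.L : ℝ) ^ i) ^ 2 ≤ ∑ i ∈ range j, (P.L : ℝ) ^ j * (P.L : ℝ) ^ i := by
        refine Finset.sum_le_sum fun i hi => ?_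
        have hij : (P.L : ℝ) ^ i ≤ (P.L : ℝ) ^ j := pow_le_pow_right₀ hL1 (Finset.mem_range.mp hi).le
        rw [sq]; exact mul_le_mul_of_nonneg_right hij (by positivity)
    _ = (P.L : ℝ) ^ j * ∑ i ∈ range j, (P.L : ℝ) ^ i := by rw [Finset.mul_sum]
    _ ≤ (P.L : ℝ) ^ j * (P.L : ℝ) ^ j := mul_le_mul_of_nonneg_left (sum_range_pow_le j) (by positivity)

/-- The covariant gradient energy of `G` from that of `S` and the mass of `G − S`: `‖∇^V G‖ ≤ ‖∇^V S‖ + 2√d·‖G − S‖`. [folklore] -/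
theorem sqrt_grad_le_of_split {j : ℕ} (V : GaugeField P j (Matrix.specialUnitaryGroup (Fin N) ℂ)) (G S : PBond P j → Matrix (Fin N) (Fin N) ℂ) :
    Real.sqrt (∑ b : PBond P j, ∑ ν : Fin P.d,
        ‖((V ⟨b.src, ν⟩ : Matrix.specialUnitaryGroup (Fin N) ℂ) : Matrix (Fin N) (Fin N) ℂ) * G ⟨b.src.shift ν, b.dir⟩
            * star ((V ⟨b.src, ν⟩ : Matrix.specialUnitaryGroup (Fin N) ℂ) : Matrix (Fin N) (Fin N) ℂ) - G b‖ ^ 2)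
      ≤ Real.sqrt (∑ b : PBond P j, ∑ ν : Fin P.d,
          ‖((V ⟨b.src, ν⟩ : Matrix.specialUnitaryGroup (Fin N) ℂ) : Matrix (Fin N) (Fin N) ℂ) * S ⟨b.src.shift ν, b.dir⟩
              * star ((V ⟨b.src, ν⟩ : Matrix.specialUnitaryGroup (Fin N) ℂ) : Matrix (Fin N) (Fin N) ℂ) - S b‖ ^ 2)
        + 2 * Real.sqrt P.d * Real.sqrt (∑ b : PBond P j, ‖G b - S b‖ ^ 2) := by
  have h := sqrt_sum_normSq_covGrad_add_le V S (fun b => G b - S b)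
  have h2 := sqrt_sum_normSq_covGrad_le_mass V (fun b => G b - S b)
  simp only [add_sub_cancel] at h
  linarith

set_option maxHeartbeats 400000 in
/-- ★★★ **(R-B) AT `d = 3`: THE `(H¹)^*`-BOUND OF THE COARSE GAUGE FUNCTION OF THE CURVED STRUCTURE THEOREM** — the `hΛ` row of the S2′ assembly
`Prop7CurvedLandauCoercivity.sum_normSq_le_curl_sq_of_landau_of_structure_T3` for the recursion of record, with the gradient-growth and mass rows discharged:
`Σ_y ‖Λ_k(y)‖² ≤ [(d+2)²N·L⁴·E + 4(d+2)²d³(3N+2d)·L⁶·E′]·L^k/(√L−1)²` with `E`, `E′` as in the file header (explicit; `E′ = O(ε²L^{−2k})Σ‖Y‖²`, the mass part of `E` is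
`O(ε²L⁴L^{−2k})Σ‖Y‖²`). [cite: Balaban1984PropagatorsI, (1.18)-(1.20) pp.19-20; Balaban1985BackgroundPropagators, Thm 3.11 p.416] -/
theorem sum_normSq_covIterLambda_le_T3 (hd : P.d = 3) (k : ℕ) (hk : k ≤ P.m + P.K)
    (U₀ : GaugeField P 0 (Matrix.specialUnitaryGroup (Fin N) ℂ)) {ε : ℝ} (hε : 0 < ε)
    (hε3 : (143 * ((((P.d + 4 : ℕ) : ℝ)) ^ 2 / 4) ^ 2) * ε ≤ 1 / 3)
    (hε2 : 2 * ε ≤ 2 * deltaSU (Fin N) / (((P.d + 4) * P.L : ℕ) : ℝ) ^ 2)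
    (hε24 : (((P.d + 2) * P.L : ℕ) : ℝ) ^ 2 / 4 * (2 * ε) ≤ 1 / 24)
    (hU : PlaqSmall (ε * (((P.L : ℝ) ^ k)⁻¹) ^ 2) U₀) (Y : PBond P 0 → Matrix (Fin N) (Fin N) ℂ)
    (G S : (j : ℕ) → PBond P j → Matrix (Fin N) (Fin N) ℂ) (Λ : (j : ℕ) → Site P j → Matrix (Fin N) (Fin N) ℂ) (hΛ0 : ∀ y, Λ 0 y = 0)
    (hG0 : ∀ b, G 0 b = Y b) (hS0 : ∀ b, S 0 b = Y b)
    (hΛs : ∀ (j : ℕ) (z : Site P (j + 1)), Λ (j + 1) z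
      = ((Fintype.card (Idx P) : ℂ))⁻¹ • ∑ i : Idx P,
          covWalkSum (Averaging.iter (fun i => blockAvg (P := P) (j := i) (expMeanLogSU (n := Fin N))) j U₀) (G j)
            (walk (emb z) (stairWord i.2.1 (off i.1)))
        + Λ j (emb z))
    (hGs : ∀ (k : ℕ) (c : PBond P (k + 1)), G (k + 1) c
      = (fderiv ℂ (eml : (Idx P → Matrix (Fin N) (Fin N) ℂ) → Matrix (Fin N) (Fin N) ℂ)
            (fun i => ((loopHol (Averaging.iter (fun i => blockAvg (P := P) (j := i) (expMeanLogSU (n := Fin N))) k U₀) c i :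
              Matrix.specialUnitaryGroup (Fin N) ℂ) : Matrix (Fin N) (Fin N) ℂ))
            (fun i => covWalkSum (Averaging.iter (fun i => blockAvg (P := P) (j := i) (expMeanLogSU (n := Fin N))) k U₀) (G k)
                (walk (emb c.src) (loopWord P.L c.dir (off i.1) i.2.1 i.2.2))
              * ((loopHol (Averaging.iter (fun i => blockAvg (P := P) (j := i) (expMeanLogSU (n := Fin N))) k U₀) c i :
                Matrix.specialUnitaryGroup (Fin N) ℂ) : Matrix (Fin N) (Fin N) ℂ))
            * star ((corr (expMeanLogSU (n := Fin N)) (Averaging.iter (fun i => blockAvg (P := P) (j := i) (expMeanLogSU (n := Fin N))) k U₀) c :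
                Matrix.specialUnitaryGroup (Fin N) ℂ) : Matrix (Fin N) (Fin N) ℂ)
          + ((corr (expMeanLogSU (n := Fin N)) (Averaging.iter (fun i => blockAvg (P := P) (j := i) (expMeanLogSU (n := Fin N))) k U₀) c :
                Matrix.specialUnitaryGroup (Fin N) ℂ) : Matrix (Fin N) (Fin N) ℂ)
            * covWalkSum (Averaging.iter (fun i => blockAvg (P := P) (j := i) (expMeanLogSU (n := Fin N))) k U₀) (G k)
                (walk (emb c.src) (List.replicate P.L (c.dir, true)))
            * star ((corr (expMeanLogSU (n := Fin N)) (Averaging.iter (fun i => blockAvg (P := P) (j := i) (expMeanLogSU (n := Fin N))) k U₀) c :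
                Matrix.specialUnitaryGroup (Fin N) ℂ) : Matrix (Fin N) (Fin N) ℂ))
        - ((((Fintype.card (Idx P) : ℂ))⁻¹ • ∑ i : Idx P,
              covWalkSum (Averaging.iter (fun i => blockAvg (P := P) (j := i) (expMeanLogSU (n := Fin N))) k U₀) (G k) (walk (emb c.src) (stairWord i.2.1 (off i.1))))
            - ((Averaging.iter (fun i => blockAvg (P := P) (j := i) (expMeanLogSU (n := Fin N))) (k + 1) U₀ c : Matrix.specialUnitaryGroup (Fin N) ℂ) :
                Matrix (Fin N) (Fin N) ℂ)
              * (((Fintype.card (Idx P) : ℂ))⁻¹ • ∑ i : Idx P,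
                  covWalkSum (Averaging.iter (fun i => blockAvg (P := P) (j := i) (expMeanLogSU (n := Fin N))) k U₀) (G k) (walk (emb c.tgt) (stairWord i.2.1 (off i.1))))
              * star ((Averaging.iter (fun i => blockAvg (P := P) (j := i) (expMeanLogSU (n := Fin N))) (k + 1) U₀ c :
                Matrix.specialUnitaryGroup (Fin N) ℂ) : Matrix (Fin N) (Fin N) ℂ)))
    (hSs : ∀ (k : ℕ) (c : PBond P (k + 1)), S (k + 1) c
      = ((Fintype.card (Idx P) : ℂ))⁻¹ • ∑ i : Idx P,
          ((holAt (Averaging.iter (fun i => blockAvg (P := P) (j := i) (expMeanLogSU (n := Fin N))) k U₀) (walk (emb c.src) (stairWord i.2.1 (off i.1))) :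
              Matrix.specialUnitaryGroup (Fin N) ℂ) : Matrix (Fin N) (Fin N) ℂ) *
            covWalkSum (Averaging.iter (fun i => blockAvg (P := P) (j := i) (expMeanLogSU (n := Fin N))) k U₀) (S k)
              (walk (walkEnd (emb c.src) (stairWord i.2.1 (off i.1))) (List.replicate P.L (c.dir, true))) *
          star ((holAt (Averaging.iter (fun i => blockAvg (P := P) (j := i) (expMeanLogSU (n := Fin N))) k U₀) (walk (emb c.src) (stairWord i.2.1 (off i.1))) :
              Matrix.specialUnitaryGroup (Fin N) ℂ) : Matrix (Fin N) (Fin N) ℂ))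
    :
    ∑ y : Site P k, ‖Λ k y‖ ^ 2
      ≤ (((P.d : ℝ) + 2) ^ 2 * N * (P.L : ℝ) ^ 4 * 1
            * (Real.sqrt (∑ b : PBond P 0, ∑ ν : Fin P.d,
          ‖((U₀ ⟨b.src, ν⟩ : Matrix.specialUnitaryGroup (Fin N) ℂ) : Matrix (Fin N) (Fin N) ℂ) * Y ⟨b.src.shift ν, b.dir⟩
              * star ((U₀ ⟨b.src, ν⟩ : Matrix.specialUnitaryGroup (Fin N) ℂ) : Matrix (Fin N) (Fin N) ℂ) - Y b‖ ^ 2)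
                + (154 * Real.sqrt 3 + 25 * Real.sqrt 3 * Real.sqrt P.L
                    * (159 * (((P.d + 2) * P.L : ℕ) : ℝ) * Real.sqrt (2 * P.d * (P.L : ℝ) ^ P.d * (2 * P.d)))
                    * Real.exp ((159 * (((P.d + 2) * P.L : ℕ) : ℝ) * Real.sqrt (2 * P.d * (P.L : ℝ) ^ P.d * (2 * P.d))) / (Real.sqrt P.L)⁻¹
                        * ∑ j ∈ range k, (((P.d + 2) * P.L : ℕ) : ℝ) ^ 2 / 4 * (2 * ε * ((P.L : ℝ) ^ j * ((P.L : ℝ) ^ k)⁻¹) ^ 2)))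
                  * ε * (P.L : ℝ) ^ 2 * ((P.L : ℝ) ^ k)⁻¹ * Real.sqrt (∑ b : PBond P 0, ‖Y b‖ ^ 2)) ^ 2
          + 4 * ((P.d : ℝ) + 2) ^ 2 * (P.d : ℝ) ^ 3 * (3 * N + 2 * P.d) * (P.L : ℝ) ^ 6 * 1
            * (4 * ε ^ 2 * (((P.L : ℝ) ^ k)⁻¹) ^ 2
              * Real.exp ((159 * (((P.d + 2) * P.L : ℕ) : ℝ) * Real.sqrt (2 * P.d * (P.L : ℝ) ^ P.d * (2 * P.d))) / (Real.sqrt P.L)⁻¹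
                  * ∑ j ∈ range k, (((P.d + 2) * P.L : ℕ) : ℝ) ^ 2 / 4 * (2 * ε * ((P.L : ℝ) ^ j * ((P.L : ℝ) ^ k)⁻¹) ^ 2)) ^ 2
              * ∑ b : PBond P 0, ‖Y b‖ ^ 2))
        * ((P.L : ℝ) ^ k / (Real.sqrt P.L - 1) ^ 2) := by
  have hL : (0 : ℝ) < P.L := by exact_mod_cast P.L_pos
  have hL1 : (1 : ℝ) ≤ P.L := by exact_mod_cast P.L_pos
  have hsL : 0 < Real.sqrt P.L := Real.sqrt_pos.mpr hL
  have hs2 : Real.sqrt (P.L : ℝ) ^ 2 = P.L := Real.sq_sqrt hL.le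
  have hLk : (0 : ℝ) < (P.L : ℝ) ^ k := pow_pos hL _
  have hd3 : (P.d : ℝ) = 3 := by exact_mod_cast hd
  -- names
  obtain ⟨M, hM⟩ : ∃ M : ℝ, M = Real.sqrt (∑ b : PBond P 0, ‖Y b‖ ^ 2) := ⟨_, rfl⟩
  obtain ⟨θ, hθ⟩ : ∃ θ : ℕ → ℝ, θ = fun j => (((P.d + 2) * P.L : ℕ) : ℝ) ^ 2 / 4 * (2 * ε * ((P.L : ℝ) ^ j * ((P.L : ℝ) ^ k)⁻¹) ^ 2) := ⟨_, rfl⟩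
  obtain ⟨κ', hκ'⟩ : ∃ κ' : ℝ, κ' = 159 * (((P.d + 2) * P.L : ℕ) : ℝ) * Real.sqrt (2 * P.d * (P.L : ℝ) ^ P.d * (2 * P.d)) := ⟨_, rfl⟩
  obtain ⟨ek, hek⟩ : ∃ ek : ℝ, ek = Real.exp (κ' / (Real.sqrt P.L)⁻¹ * ∑ j ∈ range k, θ j) := ⟨_, rfl⟩
  have hM0 : 0 ≤ M := by rw [hM]; exact Real.sqrt_nonneg _
  have hθ0 : ∀ j, 0 ≤ θ j := fun j => by rw [hθ]; positivity
  have hκ0 : 0 ≤ κ' := by rw [hκ']; positivity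
  have hek1 : 1 ≤ ek := by rw [hek]; exact Real.one_le_exp (by rw [div_inv_eq_mul]; exact mul_nonneg (mul_nonneg hκ0 hsL.le) (Finset.sum_nonneg fun j _ => hθ0 j))
  have hek0 : 0 ≤ ek := zero_le_one.trans hek1
  -- `θ_j ≤ ((d+2)L)²/4·2ε`, hence `≤ 1/24` and `< δ_N`; and `θ` dominates the loop variables of the tower
  have hθle : ∀ j, j ≤ k → θ j ≤ (((P.d + 2) * P.L : ℕ) : ℝ) ^ 2 / 4 * (2 * ε) := by
    intro j hj
    rw [hθ]; simp only []
    have hx1 : (P.L : ℝ) ^ j * ((P.L : ℝ) ^ k)⁻¹ ≤ 1 := by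
      rw [mul_inv_le_iff₀ hLk, one_mul]; exact pow_le_pow_right₀ hL1 hj
    have hx0 : 0 ≤ (P.L : ℝ) ^ j * ((P.L : ℝ) ^ k)⁻¹ := by positivity
    have : 2 * ε * ((P.L : ℝ) ^ j * ((P.L : ℝ) ^ k)⁻¹) ^ 2 ≤ 2 * ε :=
      mul_le_of_le_one_right (by positivity) (pow_le_one₀ hx0 hx1)
    exact mul_le_mul_of_nonneg_left this (by positivity)
  have hα : ∀ j, j < k → ∀ (c : PBond P (j + 1)) (i : Idx P),
      dist1 (loopHol (Averaging.iter (fun i => blockAvg (P := P) (j := i) (expMeanLogSU (n := Fin N))) j U₀) c i) ≤ θ j := by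
    intro j hj c i
    have hpl : PlaqSmall (2 * ε * ((P.L : ℝ) ^ j * ((P.L : ℝ) ^ k)⁻¹) ^ 2)
        (Averaging.iter (fun i => blockAvg (P := P) (j := i) (expMeanLogSU (n := Fin N))) j U₀) := fun q => (tower_plaq_lt k hε hε3 hε2 hU hj.le q).1
    rw [hθ]
    exact dist1_loopHol_le (by positivity) hpl c i
  -- A_j ≤ ((d+2)L)²/4·2ε(L^k)⁻²·L^jL^j and A_j ≤ A_k
  have hA : ∀ j, ∑ i ∈ range j, θ i ≤ (((P.d + 2) * P.L : ℕ) : ℝ) ^ 2 / 4 * (2 * ε) * (((P.L : ℝ) ^ k)⁻¹) ^ 2 * ((P.L : ℝ) ^ j * (P.L : ℝ) ^ j) := by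
    intro j
    have e : ∑ i ∈ range j, θ i = (((P.d + 2) * P.L : ℕ) : ℝ) ^ 2 / 4 * (2 * ε) * (((P.L : ℝ) ^ k)⁻¹) ^ 2 * ∑ i ∈ range j, ((P.L : ℝ) ^ i) ^ 2 := by
      rw [hθ, Finset.mul_sum]; exact Finset.sum_congr rfl fun i _ => by ring
    rw [e]
    exact mul_le_mul_of_nonneg_left (sum_range_pow_two_mul_le j) (by positivity)
  have hAk : ∀ j, j ≤ k → ∑ i ∈ range j, θ i ≤ ∑ i ∈ range k, θ i := fun j hj =>
    Finset.sum_le_sum_of_subset_of_nonneg (Finset.range_subset_range.mpr hj) fun i _ _ => hθ0 i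
  -- the two displayed rows, level by level
  set g0 : ℝ := Real.sqrt (∑ b : PBond P 0, ∑ ν : Fin P.d,
      ‖((U₀ ⟨b.src, ν⟩ : Matrix.specialUnitaryGroup (Fin N) ℂ) : Matrix (Fin N) (Fin N) ℂ) * Y ⟨b.src.shift ν, b.dir⟩
          * star ((U₀ ⟨b.src, ν⟩ : Matrix.specialUnitaryGroup (Fin N) ℂ) : Matrix (Fin N) (Fin N) ℂ) - Y b‖ ^ 2) with hg0
  have hg00 : 0 ≤ g0 := Real.sqrt_nonneg _
  set C1 : ℝ := 154 * Real.sqrt 3 + 25 * Real.sqrt 3 * Real.sqrt P.L * κ' * ek with hC1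
  have hC10 : 0 ≤ C1 := by positivity
  set E : ℝ := (g0 + C1 * ε * (P.L : ℝ) ^ 2 * ((P.L : ℝ) ^ k)⁻¹ * M) ^ 2 with hE
  set E' : ℝ := 4 * ε ^ 2 * (((P.L : ℝ) ^ k)⁻¹) ^ 2 * ek ^ 2 * ∑ b : PBond P 0, ‖Y b‖ ^ 2 with hE'
  have hE0 : 0 ≤ E := sq_nonneg _
  have hE'0 : 0 ≤ E' := by positivity
  have hlev : ∀ j, j < k →
      ∑ b : PBond P j, ∑ ν : Fin P.d,
        ‖((Averaging.iter (fun i => blockAvg (P := P) (j := i) (expMeanLogSU (n := Fin N))) j U₀ ⟨b.src, ν⟩ : Matrix.specialUnitaryGroup (Fin N) ℂ) :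
              Matrix (Fin N) (Fin N) ℂ) * G j ⟨b.src.shift ν, b.dir⟩
            * star ((Averaging.iter (fun i => blockAvg (P := P) (j := i) (expMeanLogSU (n := Fin N))) j U₀ ⟨b.src, ν⟩ : Matrix.specialUnitaryGroup (Fin N) ℂ) :
              Matrix (Fin N) (Fin N) ℂ) - G j b‖ ^ 2 ≤ 1 * (P.L : ℝ) ^ j * E
      ∧ (2 * ε * ((P.L : ℝ) ^ j * ((P.L : ℝ) ^ k)⁻¹) ^ 2) ^ 2 * ∑ b : PBond P j, ‖G j b‖ ^ 2 ≤ 1 * (P.L : ℝ) ^ j * E' := by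
    intro j hj
    have hjk : j ≤ k := hj.le
    have hjK : j ≤ P.m + P.K := hjk.trans hk
    obtain ⟨hmS, hgS⟩ := lineIter_mass_grad_le_T3 hd U₀ Y S hS0 hSs hk hε hε3 hε2 hU hjk
    have hB := sqrt_sum_normSq_reduced_sub_lineIter_le U₀ Y G S hG0 hS0 hGs hSs θ hθ0 hjK
      (fun i hi => hα i (lt_trans hi hj)) (fun i hi => (hθle i (hi.le.trans hjk)).trans hε24)
      (fun i hi => lt_of_le_of_lt (hθle i (hi.le.trans hjk)) (theta_lt_deltaSU (P := P) (n := Fin N) hε hε2))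
    rw [rho_m_eq hd, ← hκ'] at hB
    obtain ⟨hGS, hGm⟩ := hB
    -- `e_j ≤ e_k`
    have hej : Real.exp (κ' / (Real.sqrt P.L)⁻¹ * ∑ i ∈ range j, θ i) ≤ ek := by
      rw [hek]; refine Real.exp_le_exp.mpr (mul_le_mul_of_nonneg_left (hAk j hjk) ?_)
      rw [div_inv_eq_mul]; positivity
    -- powers
    have hpj : (Real.sqrt P.L)⁻¹ ^ j * Real.sqrt P.L ^ j = 1 := by rw [← mul_pow, inv_mul_cancel₀ hsL.ne', one_pow]
    have hsj2 : Real.sqrt P.L ^ j * Real.sqrt P.L ^ j = (P.L : ℝ) ^ j := by rw [← mul_pow, ← sq, hs2]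
    have hsj0 : 0 < Real.sqrt P.L ^ j := pow_pos hsL _
    have hLj : (P.L : ℝ) ^ j ≤ (P.L : ℝ) ^ k := pow_le_pow_right₀ hL1 hjk
    have hLjk : (P.L : ℝ) ^ j * ((P.L : ℝ) ^ k)⁻¹ ≤ 1 := by rw [mul_inv_le_iff₀ hLk, one_mul]; exact hLj
    -- (i) mass of `G_j − S_j`: `√Σ‖G_j − S_j‖² ≤ √L·(√L)^{-j}·κ'·A_j·e_k·M`
    have hdiff : Real.sqrt (∑ c : PBond P j, ‖G j c - S j c‖ ^ 2)
        ≤ Real.sqrt P.L * (Real.sqrt P.L)⁻¹ ^ j * κ' * (∑ i ∈ range j, θ i) * ek * M := by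
      have h1 : (Real.sqrt P.L)⁻¹ * Real.sqrt (∑ c : PBond P j, ‖G j c - S j c‖ ^ 2)
          ≤ (Real.sqrt P.L)⁻¹ ^ j * κ' * (∑ i ∈ range j, θ i) * ek * M := by
        refine hGS.trans ?_
        rw [← hM]
        have h0 : 0 ≤ (Real.sqrt P.L)⁻¹ ^ j * κ' * (∑ i ∈ range j, θ i) := by
          have := Finset.sum_nonneg fun i (_ : i ∈ range j) => hθ0 i; positivity
        exact mul_le_mul_of_nonneg_right (mul_le_mul_of_nonneg_left hej h0) hM0
      have h2 := mul_le_mul_of_nonneg_left h1 hsL.le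
      rw [← mul_assoc, mul_inv_cancel₀ hsL.ne', one_mul] at h2
      linarith only [h2]
    -- (ii) the gradient of `G_j`
    have hgradG := (sqrt_grad_le_of_split (Averaging.iter (fun i => blockAvg (P := P) (j := i) (expMeanLogSU (n := Fin N))) j U₀) (G j) (S j)).trans
      (add_le_add hgS (mul_le_mul_of_nonneg_left hdiff (by positivity)))
    rw [← hM, hd3] at hgradG
    -- bound the right-hand side by `(√L)^j·(g0 + C1·ε·L²·(L^k)⁻¹·M)`
    have hkey : Real.sqrt P.L ^ j * g0 + 154 * Real.sqrt 3 * ε * (P.L : ℝ) ^ 2 * Real.sqrt P.L ^ j * ((P.L : ℝ) ^ j * (((P.L : ℝ) ^ k)⁻¹) ^ 2) * M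
          + 2 * Real.sqrt 3 * (Real.sqrt P.L * (Real.sqrt P.L)⁻¹ ^ j * κ' * (∑ i ∈ range j, θ i) * ek * M)
        ≤ Real.sqrt P.L ^ j * (g0 + C1 * ε * (P.L : ℝ) ^ 2 * ((P.L : ℝ) ^ k)⁻¹ * M) := by
      -- the `A_j` term
      have hAj := hA j
      have hd2 : (((P.d + 2) * P.L : ℕ) : ℝ) ^ 2 / 4 = 25 / 4 * (P.L : ℝ) ^ 2 := by push_cast; rw [hd3]; ring
      rw [hd2] at hAj
      -- `(√L)^{-j}·L^j·L^j = (√L)^j·L^j`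
      have hq : (Real.sqrt P.L)⁻¹ ^ j * ((P.L : ℝ) ^ j * (P.L : ℝ) ^ j) = Real.sqrt P.L ^ j * (P.L : ℝ) ^ j := by
        have : (Real.sqrt P.L)⁻¹ ^ j * (P.L : ℝ) ^ j = Real.sqrt P.L ^ j := by
          rw [← hsj2, ← mul_assoc, hpj, one_mul]
        rw [← mul_assoc, this]
      have hT2 : Real.sqrt P.L * (Real.sqrt P.L)⁻¹ ^ j * κ' * (∑ i ∈ range j, θ i) * ek * M
          ≤ Real.sqrt P.L * κ' * ek * M * (25 / 4 * (P.L : ℝ) ^ 2 * (2 * ε) * (((P.L : ℝ) ^ k)⁻¹) ^ 2) * (Real.sqrt P.L ^ j * (P.L : ℝ) ^ j) := by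
        have h0 : 0 ≤ Real.sqrt P.L * (Real.sqrt P.L)⁻¹ ^ j * κ' * ek * M := by positivity
        have := mul_le_mul_of_nonneg_left hAj h0
        rw [← hq]
        linarith only [this]
      -- `L^j(L^k)⁻² ≤ (L^k)⁻¹`
      have hLL : (P.L : ℝ) ^ j * (((P.L : ℝ) ^ k)⁻¹) ^ 2 ≤ ((P.L : ℝ) ^ k)⁻¹ := by
        rw [sq, ← mul_assoc]; exact mul_le_of_le_one_left (inv_nonneg.mpr hLk.le) hLjk
      have hT1 : 154 * Real.sqrt 3 * ε * (P.L : ℝ) ^ 2 * Real.sqrt P.L ^ j * ((P.L : ℝ) ^ j * (((P.L : ℝ) ^ k)⁻¹) ^ 2) * M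
          ≤ 154 * Real.sqrt 3 * ε * (P.L : ℝ) ^ 2 * Real.sqrt P.L ^ j * ((P.L : ℝ) ^ k)⁻¹ * M := by
        have h0 : 0 ≤ 154 * Real.sqrt 3 * ε * (P.L : ℝ) ^ 2 * Real.sqrt P.L ^ j := by positivity
        exact mul_le_mul_of_nonneg_right (mul_le_mul_of_nonneg_left hLL h0) hM0
      have hT2' : Real.sqrt P.L * κ' * ek * M * (25 / 4 * (P.L : ℝ) ^ 2 * (2 * ε) * (((P.L : ℝ) ^ k)⁻¹) ^ 2) * (Real.sqrt P.L ^ j * (P.L : ℝ) ^ j)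
          ≤ Real.sqrt P.L * κ' * ek * M * (25 / 2 * (P.L : ℝ) ^ 2 * ε * ((P.L : ℝ) ^ k)⁻¹) * Real.sqrt P.L ^ j := by
        have h0 : 0 ≤ Real.sqrt P.L * κ' * ek * M := by positivity
        have e1 : Real.sqrt P.L * κ' * ek * M * (25 / 4 * (P.L : ℝ) ^ 2 * (2 * ε) * (((P.L : ℝ) ^ k)⁻¹) ^ 2) * (Real.sqrt P.L ^ j * (P.L : ℝ) ^ j)
            = Real.sqrt P.L * κ' * ek * M * (25 / 2 * (P.L : ℝ) ^ 2 * ε) * Real.sqrt P.L ^ j * ((P.L : ℝ) ^ j * (((P.L : ℝ) ^ k)⁻¹) ^ 2) := by ring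
        rw [e1]
        have h1 : 0 ≤ Real.sqrt P.L * κ' * ek * M * (25 / 2 * (P.L : ℝ) ^ 2 * ε) * Real.sqrt P.L ^ j := by positivity
        have := mul_le_mul_of_nonneg_left hLL h1
        linarith only [this]
      rw [hC1]
      have hT3 := mul_le_mul_of_nonneg_left (hT2.trans hT2') (by positivity : (0 : ℝ) ≤ 2 * Real.sqrt 3)
      linarith only [hT1, hT3]
    refine ⟨?_, ?_⟩
    · -- square the gradient bound
      have hR0 : 0 ≤ Real.sqrt P.L ^ j * (g0 + C1 * ε * (P.L : ℝ) ^ 2 * ((P.L : ℝ) ^ k)⁻¹ * M) := by positivity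
      have hfin := (hgradG.trans hkey)
      have hsq := pow_le_pow_left₀ (Real.sqrt_nonneg _) hfin 2
      rw [Real.sq_sqrt (Finset.sum_nonneg fun _ _ => Finset.sum_nonneg fun _ _ => sq_nonneg _), mul_pow] at hsq
      rw [one_mul, hE]
      calc _ ≤ (Real.sqrt P.L ^ j) ^ 2 * (g0 + C1 * ε * (P.L : ℝ) ^ 2 * ((P.L : ℝ) ^ k)⁻¹ * M) ^ 2 := hsq
        _ = (P.L : ℝ) ^ j * (g0 + C1 * ε * (P.L : ℝ) ^ 2 * ((P.L : ℝ) ^ k)⁻¹ * M) ^ 2 := by rw [sq (Real.sqrt P.L ^ j), hsj2]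
    · -- the mass row
      have hm2 : ∑ b : PBond P j, ‖G j b‖ ^ 2 ≤ ((Real.sqrt P.L)⁻¹ ^ j * ek * M) ^ 2 := by
        have h1 : Real.sqrt (∑ b : PBond P j, ‖G j b‖ ^ 2) ≤ (Real.sqrt P.L)⁻¹ ^ j * ek * M := by
          refine hGm.trans ?_
          rw [← hM]
          exact mul_le_mul_of_nonneg_right (mul_le_mul_of_nonneg_left hej (by positivity)) hM0
        have := pow_le_pow_left₀ (Real.sqrt_nonneg _) h1 2
        rwa [Real.sq_sqrt (Finset.sum_nonneg fun _ _ => sq_nonneg _)] at this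
      rw [one_mul, hE']
      have hY0 : 0 ≤ ∑ b : PBond P 0, ‖Y b‖ ^ 2 := Finset.sum_nonneg fun _ _ => sq_nonneg _
      -- `(2ε(L^j/L^k)²)²·(L^{-j}) ≤ 4ε²(L^k)⁻²·L^j`
      have hinvj : ((Real.sqrt P.L)⁻¹ ^ j) ^ 2 * (P.L : ℝ) ^ j = 1 := by
        rw [← hsj2]
        have e : ((Real.sqrt P.L)⁻¹ ^ j) ^ 2 * (Real.sqrt P.L ^ j * Real.sqrt P.L ^ j)
            = ((Real.sqrt P.L)⁻¹ ^ j * Real.sqrt P.L ^ j) * ((Real.sqrt P.L)⁻¹ ^ j * Real.sqrt P.L ^ j) := by ring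
        rw [e, hpj, one_mul]
      have hcoef : (2 * ε * ((P.L : ℝ) ^ j * ((P.L : ℝ) ^ k)⁻¹) ^ 2) ^ 2 * ((Real.sqrt P.L)⁻¹ ^ j) ^ 2
          ≤ (P.L : ℝ) ^ j * (4 * ε ^ 2 * (((P.L : ℝ) ^ k)⁻¹) ^ 2) := by
        -- multiply the claim by `L^j > 0` and use `hinvj`
        have hLj0 : (0 : ℝ) < (P.L : ℝ) ^ j := pow_pos hL _
        rw [← mul_le_mul_iff_of_pos_right hLj0]
        have e1 : (2 * ε * ((P.L : ℝ) ^ j * ((P.L : ℝ) ^ k)⁻¹) ^ 2) ^ 2 * ((Real.sqrt P.L)⁻¹ ^ j) ^ 2 * (P.L : ℝ) ^ j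
            = 4 * ε ^ 2 * (((P.L : ℝ) ^ k)⁻¹) ^ 2 * ((P.L : ℝ) ^ j * ((P.L : ℝ) ^ k)⁻¹) ^ 2 * ((P.L : ℝ) ^ j * (P.L : ℝ) ^ j)
              * (((Real.sqrt P.L)⁻¹ ^ j) ^ 2 * (P.L : ℝ) ^ j) := by ring
        rw [e1, hinvj, mul_one]
        have hx0 : 0 ≤ (P.L : ℝ) ^ j * ((P.L : ℝ) ^ k)⁻¹ := by positivity
        have hx2 : ((P.L : ℝ) ^ j * ((P.L : ℝ) ^ k)⁻¹) ^ 2 ≤ 1 := pow_le_one₀ hx0 hLjk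
        have hLL2 : ((P.L : ℝ) ^ j * ((P.L : ℝ) ^ k)⁻¹) ^ 2 * ((P.L : ℝ) ^ j * (P.L : ℝ) ^ j) ≤ (P.L : ℝ) ^ j * (P.L : ℝ) ^ j :=
          mul_le_of_le_one_left (by positivity) hx2
        have h4 : 0 ≤ 4 * ε ^ 2 * (((P.L : ℝ) ^ k)⁻¹) ^ 2 := by positivity
        have := mul_le_mul_of_nonneg_left hLL2 h4
        linarith only [this]
      calc (2 * ε * ((P.L : ℝ) ^ j * ((P.L : ℝ) ^ k)⁻¹) ^ 2) ^ 2 * ∑ b : PBond P j, ‖G j b‖ ^ 2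
          ≤ (2 * ε * ((P.L : ℝ) ^ j * ((P.L : ℝ) ^ k)⁻¹) ^ 2) ^ 2 * (((Real.sqrt P.L)⁻¹ ^ j * ek * M) ^ 2) :=
            mul_le_mul_of_nonneg_left hm2 (sq_nonneg _)
        _ = ((2 * ε * ((P.L : ℝ) ^ j * ((P.L : ℝ) ^ k)⁻¹) ^ 2) ^ 2 * ((Real.sqrt P.L)⁻¹ ^ j) ^ 2) * (ek ^ 2 * M ^ 2) := by ring
        _ ≤ (P.L : ℝ) ^ j * (4 * ε ^ 2 * (((P.L : ℝ) ^ k)⁻¹) ^ 2) * (ek ^ 2 * M ^ 2) := mul_le_mul_of_nonneg_right hcoef (by positivity)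
        _ = (P.L : ℝ) ^ j * (4 * ε ^ 2 * (((P.L : ℝ) ^ k)⁻¹) ^ 2 * ek ^ 2 * ∑ b : PBond P 0, ‖Y b‖ ^ 2) := by
            rw [hM, Real.sq_sqrt hY0]; ring
  -- the assembly
  have hmain := sum_normSq_covIterLambda_le k hk U₀ hε hε3 hε2 hU G Λ hΛ0 hΛs zero_le_one zero_le_one hE0 hE'0
    (fun j hj => (hlev j hj).1) (fun j hj => (hlev j hj).2)
  subst hek
  subst hκ'
  subst hθ
  subst hM
  exact hmain

end Summit.QuantumFields.YangMills.Theorems.Prop7CovIterLambdaHLambda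

end
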